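import Mathlib
import Summits.Ventures.PercRepro2.Defs
import Summits.Ventures.PercRepro2.Independence
import Summits.Ventures.PercRepro2.Harris
import Summits.Ventures.PercRepro2.ObsIndependence
import Summits.Ventures.PercRepro2.CoinDefs
import Summits.Ventures.PercRepro2.CoinSinkAlg
import Summits.Ventures.PercRepro2.CoinArcsOff

/-!
# The SINK case of row 2′DARC: a kernel-checked reduction to four BHK-type facts (blind cell
PercRepro2, night-2; proofs/NIGHT2-DARC.md §8)

Let `w ∉ T` be the head of the arc `u → w` and suppose every arc out of `w` lands in `T`, the coins
carrying those arcs having all their tails in `Z := insert w T` (single arcs `w → t` or antiparallel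
pairs `{w → t, t → w}`: the mixed case).  Conditioning on the set `F` of out-coins of `w`
(`gateEvent_sink_decomp`, `avoidEvent_sink_decomp` of `CoinArcsOff.lean`) gives two branches inside
which reachability is that of the reduced arc map `arcsOff arcs Z`, whose events do not depend on `F`,
so every mass factorises (`expect_mul_eq_mul_of_dependsOn`).  The cleared gate functional then equals
`P(C)·branch₁ + P(Cᶜ)·branch₃` and the two-branch sign lemma `sink_alg` (`CoinSinkAlg.lean`) closes
it from (i) `Cov(X, Y | R₀_T) ≥ 0`, (ii) `Cov(X, Y | R₀_{T∪{u,w}}) ≥ 0` and (iii) the Lemma-A shift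
orderings `E[· | R₀_T] ≥ E[· | R₀_{T∪{w}}] ≥ E[· | R₀_{T∪{u,w}}]` for both markers — four instances of
directed BHK 1.3 on the mixed system `D₀ = (E, arcsOff arcs Z)`, taken here as HYPOTHESES (cleared
forms); `darc_of_sink` is therefore CONDITIONAL on directed BHK for mixed coin systems.
-/

namespace Summit.Ventures.PercRepro2.Coin

/-! ## Masses factorise across the out-coins of `w`; the conditional theorem -/

section Theorem

open Classical

variable {V : Type*} {E : Type*} [DecidableEq V] [Fintype E] [DecidableEq E]
  {R : Type*} [Field R] [LinearOrder R] [IsStrictOrderedRing R]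

omit [DecidableEq V] [Fintype E] [DecidableEq E] in
/-- The closed-branch event depends only on the out-coins of `w`. -/
lemma dependsOn_outClosed (arcs : E → Finset (V × V)) (w : V) :
    DependsOn (· ∈ outClosed arcs w) (outCoins arcs w) := by
  intro ω ω' h
  simp only [outClosed, Set.mem_setOf_eq, eq_iff_iff]
  constructor
  · intro hω e he; rw [← h e he]; exact hω e he
  · intro hω e he; rw [h e he]; exact hω e he

omit [Fintype E] [DecidableEq E] [LinearOrder R] [IsStrictOrderedRing R] in
/-- A reduced-map cluster observable on a reduced-map avoidance event depends only on the coins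
outside the out-coins of `w`. -/
lemma dependsOn_reduced (arcs : E → Finset (V × V)) (w : V) (T : Finset V)
    (hT : OutCoinsTailsIn arcs w T) (s a : V) (X : Finset V) :
    DependsOn (fun ω => (avoidEvent (arcsOff arcs (insert w T)) s X).indicator
      (marker (R := R) (arcsOff arcs (insert w T)) s a) ω) (outCoins arcs w)ᶜ := by
  intro ω ω' h
  have hcongr : ∀ e, arcsOff arcs (insert w T) e ≠ ∅ → ω e = ω' e := by
    intro e he
    by_cases hmem : e ∈ outCoins arcs w
    · exact absurd (arcsOff_eq_empty_of_outCoins hT hmem) he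
    · exact h e hmem
  have hreach : ∀ x y, Reach (arcsOff arcs (insert w T)) ω x y ↔
      Reach (arcsOff arcs (insert w T)) ω' x y := fun x y => reach_arcsOff_congr hcongr
  have hmem : ω ∈ avoidEvent (arcsOff arcs (insert w T)) s X ↔
      ω' ∈ avoidEvent (arcsOff arcs (insert w T)) s X := by
    simp only [avoidEvent, Set.mem_setOf_eq, hreach]
  have hmark : marker (R := R) (arcsOff arcs (insert w T)) s a ω =
      marker (R := R) (arcsOff arcs (insert w T)) s a ω' := by
    simp only [marker, hreach]
  show (avoidEvent (arcsOff arcs (insert w T)) s X).indicator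
      (marker (R := R) (arcsOff arcs (insert w T)) s a) ω =
    (avoidEvent (arcsOff arcs (insert w T)) s X).indicator
      (marker (R := R) (arcsOff arcs (insert w T)) s a) ω'
  by_cases hω : ω ∈ avoidEvent (arcsOff arcs (insert w T)) s X
  · have hω' := hmem.mp hω
    rw [Set.indicator_of_mem hω, Set.indicator_of_mem hω', hmark]
  · have hω' := fun h' => hω (hmem.mpr h')
    rw [Set.indicator_of_notMem hω, Set.indicator_of_notMem hω']

omit [LinearOrder R] [IsStrictOrderedRing R] in
/-- Product rule for a branch: `E[g; 𝒞 ∩ 𝒟] = P(𝒞)·E[g; 𝒟]` when `𝒞` depends on a coin set `F` and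
`𝒟.indicator g` on its complement. -/
lemma massE_inter_of_dependsOn (p : E → R) (F : Set E) (C : Set (Config E))
    (hC : DependsOn (· ∈ C) F) (g : Config E → R) (D : Set (Config E))
    (hgD : DependsOn (D.indicator g) Fᶜ) :
    massE p g (C ∩ D) = prob p C * massE p g D := by
  unfold massE
  have h1 : (C ∩ D).indicator g = C.indicator (1 : Config E → R) * D.indicator g := by
    ext ω
    by_cases hC' : ω ∈ C <;> by_cases hD' : ω ∈ D <;> simp [Set.indicator, hC', hD']
  rw [h1, prob_eq_expect_indicator]
  exact expect_mul_eq_mul_of_dependsOn p (F₁ := F) (F₂ := Fᶜ) disjoint_compl_right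
    (dependsOn_indicator hC) hgD

omit [LinearOrder R] [IsStrictOrderedRing R] in
/-- `massE` only sees the values of the integrand on the event. -/
lemma massE_congr (p : E → R) {f g : Config E → R} {D : Set (Config E)}
    (h : ∀ ω ∈ D, f ω = g ω) : massE p f D = massE p g D := by
  unfold massE
  congr 1
  exact Set.indicator_congr h

omit [Fintype E] [DecidableEq E] [LinearOrder R] [IsStrictOrderedRing R] in
/-- The markers of the original and of the reduced map agree on the closed branch. -/
lemma marker_eq_of_outClosed (arcs : E → Finset (V × V)) (s w : V) (T : Finset V) (a : V)
    {ω : Config E} (hC : ω ∈ outClosed arcs w) (hR : ω ∈ avoidEvent arcs s T) :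
    marker (R := R) arcs s a ω = marker (R := R) (arcsOff arcs (insert w T)) s a ω := by
  simp only [marker, reach_iff_of_outClosed hC hR a]

omit [Fintype E] [DecidableEq E] [LinearOrder R] [IsStrictOrderedRing R] in
/-- The markers of the original and of the reduced map agree on avoidance events containing
`insert w T`. -/
lemma marker_eq_of_avoid (arcs : E → Finset (V × V)) (s w : V) (T X : Finset V)
    (hZX : insert w T ⊆ X) (a : V) {ω : Config E} (hR : ω ∈ avoidEvent arcs s X) :
    marker (R := R) arcs s a ω = marker (R := R) (arcsOff arcs (insert w T)) s a ω := by
  simp only [marker, reach_iff_of_avoid hZX hR a]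

/-- **THEOREM (the sink case of row 2′DARC), conditional on directed BHK for the reduced mixed
system.** Let `w ∉ T` be a sink into `T` whose out-coins have all their tails in `insert w T`
(mixed systems). Write `D₀ = arcsOff arcs (insert w T)`, `X₀ = marker D₀ s a`, `Y₀ = marker D₀ s b`,
`R₁ = R^{D₀}_T ⊇ R₂ = R^{D₀}_{T∪{w}} ⊇ R₃ = R^{D₀}_{T∪{u,w}}`. If the three events have positive
probability, the conditional covariances of `X₀, Y₀` on `R₁` and `R₃` are nonnegative (cleared:
`covC ≥ 0`) and the conditional means decrease along the chain (cleared forms `hA₁₂ … hB₂₃`) — four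
instances of directed BHK 1.3 in `D₀` — then the gate functional of the arc `u → w` is nonnegative:
`DARC p arcs s T a b u w`. -/
theorem darc_of_sink (p : E → R) (hp : IsProbVec p) (arcs : E → Finset (V × V)) (s : V)
    (T : Finset V) (a b u w : V) (hw : w ∉ T) (hsink : IsSinkInto arcs w T)
    (hT : OutCoinsTailsIn arcs w T)
    (hP₁ : 0 < prob p (avoidEvent (arcsOff arcs (insert w T)) s T))
    (hP₂ : 0 < prob p (avoidEvent (arcsOff arcs (insert w T)) s (insert w T)))
    (hP₃ : 0 < prob p (avoidEvent (arcsOff arcs (insert w T)) s (insert u (insert w T))))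
    (hcov₁ : 0 ≤ covC p (arcsOff arcs (insert w T)) s a b
      (avoidEvent (arcsOff arcs (insert w T)) s T))
    (hcov₃ : 0 ≤ covC p (arcsOff arcs (insert w T)) s a b
      (avoidEvent (arcsOff arcs (insert w T)) s (insert u (insert w T))))
    (hA₁₂ : massE p (marker (R := R) (arcsOff arcs (insert w T)) s a)
        (avoidEvent (arcsOff arcs (insert w T)) s (insert w T))
        * prob p (avoidEvent (arcsOff arcs (insert w T)) s T) ≤
      massE p (marker (R := R) (arcsOff arcs (insert w T)) s a)
        (avoidEvent (arcsOff arcs (insert w T)) s T)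
        * prob p (avoidEvent (arcsOff arcs (insert w T)) s (insert w T)))
    (hA₂₃ : massE p (marker (R := R) (arcsOff arcs (insert w T)) s a)
        (avoidEvent (arcsOff arcs (insert w T)) s (insert u (insert w T)))
        * prob p (avoidEvent (arcsOff arcs (insert w T)) s (insert w T)) ≤
      massE p (marker (R := R) (arcsOff arcs (insert w T)) s a)
        (avoidEvent (arcsOff arcs (insert w T)) s (insert w T))
        * prob p (avoidEvent (arcsOff arcs (insert w T)) s (insert u (insert w T))))
    (hB₁₂ : massE p (marker (R := R) (arcsOff arcs (insert w T)) s b)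
        (avoidEvent (arcsOff arcs (insert w T)) s (insert w T))
        * prob p (avoidEvent (arcsOff arcs (insert w T)) s T) ≤
      massE p (marker (R := R) (arcsOff arcs (insert w T)) s b)
        (avoidEvent (arcsOff arcs (insert w T)) s T)
        * prob p (avoidEvent (arcsOff arcs (insert w T)) s (insert w T)))
    (hB₂₃ : massE p (marker (R := R) (arcsOff arcs (insert w T)) s b)
        (avoidEvent (arcsOff arcs (insert w T)) s (insert u (insert w T)))
        * prob p (avoidEvent (arcsOff arcs (insert w T)) s (insert w T)) ≤
      massE p (marker (R := R) (arcsOff arcs (insert w T)) s b)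
        (avoidEvent (arcsOff arcs (insert w T)) s (insert w T))
        * prob p (avoidEvent (arcsOff arcs (insert w T)) s (insert u (insert w T)))) :
    DARC p arcs s T a b u w := by
  -- notation
  set Z : Finset V := insert w T with hZ
  set D₀ := arcsOff arcs Z with hD₀
  set F := outCoins arcs w with hF
  set C := outClosed arcs w with hC
  set X := marker (R := R) arcs s a with hX
  set Y := marker (R := R) arcs s b with hY
  set X₀ := marker (R := R) D₀ s a with hX₀
  set Y₀ := marker (R := R) D₀ s b with hY₀
  set R₁ := avoidEvent D₀ s T with hR₁
  set R₂ := avoidEvent D₀ s Z with hR₂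
  set R₃ := avoidEvent D₀ s (insert u Z) with hR₃
  have hZT : T ⊆ Z := Finset.subset_insert w T
  have hZZ : Z ⊆ Z := le_refl Z
  have hZ₃ : Z ⊆ insert u Z := Finset.subset_insert u Z
  -- the event identities
  have hRT : avoidEvent arcs s T = (C ∩ R₁) ∪ (Cᶜ ∩ R₂) := by
    rw [avoidEvent_sink_decomp (s := s) hsink, outClosed_inter_avoid,
      avoidEvent_arcsOff arcs hZZ s]
  have hG : gateEvent arcs s T u w = (C ∩ R₁) ∪ (Cᶜ ∩ R₃) := by
    rw [gateEvent_sink_decomp hw hsink, outClosed_inter_avoid, avoidEvent_arcsOff arcs hZ₃ s]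
  have hdisj₂ : Disjoint (C ∩ R₁) (Cᶜ ∩ R₂) :=
    Set.disjoint_left.2 fun ω h₁ h₂ => h₂.1 h₁.1
  have hdisj₃ : Disjoint (C ∩ R₁) (Cᶜ ∩ R₃) :=
    Set.disjoint_left.2 fun ω h₁ h₂ => h₂.1 h₁.1
  -- dependence structure
  have hCF : DependsOn (· ∈ C) F := dependsOn_outClosed arcs w
  have hCcF : DependsOn (· ∈ Cᶜ) F := dependsOn_compl hCF
  have hdep : ∀ (X' : Finset V) (f : Config E → R), DependsOn f Fᶜ →
      DependsOn ((avoidEvent D₀ s X').indicator f) Fᶜ := by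
    intro X' f hf ω ω' h
    have hcongr : ∀ e, D₀ e ≠ ∅ → ω e = ω' e := by
      intro e he
      by_cases hmem : e ∈ F
      · exact absurd (arcsOff_eq_empty_of_outCoins hT hmem) he
      · exact h e hmem
    have hreach : ∀ x y, Reach D₀ ω x y ↔ Reach D₀ ω' x y :=
      fun x y => reach_arcsOff_congr hcongr
    have hmem : ω ∈ avoidEvent D₀ s X' ↔ ω' ∈ avoidEvent D₀ s X' := by
      simp only [avoidEvent, Set.mem_setOf_eq, hreach]
    by_cases hω : ω ∈ avoidEvent D₀ s X'
    · rw [Set.indicator_of_mem hω, Set.indicator_of_mem (hmem.mp hω)]; exact hf h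
    · rw [Set.indicator_of_notMem hω, Set.indicator_of_notMem (fun h' => hω (hmem.mpr h'))]
  have hdepX : DependsOn X₀ Fᶜ := by
    intro ω ω' h
    have hcongr : ∀ e, D₀ e ≠ ∅ → ω e = ω' e := by
      intro e he
      by_cases hmem : e ∈ F
      · exact absurd (arcsOff_eq_empty_of_outCoins hT hmem) he
      · exact h e hmem
    have hr : Reach D₀ ω s a ↔ Reach D₀ ω' s a := reach_arcsOff_congr hcongr
    simp only [hX₀, marker, hr]
  have hdepY : DependsOn Y₀ Fᶜ := by
    intro ω ω' h
    have hcongr : ∀ e, D₀ e ≠ ∅ → ω e = ω' e := by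
      intro e he
      by_cases hmem : e ∈ F
      · exact absurd (arcsOff_eq_empty_of_outCoins hT hmem) he
      · exact h e hmem
    have hr : Reach D₀ ω s b ↔ Reach D₀ ω' s b := reach_arcsOff_congr hcongr
    simp only [hY₀, marker, hr]
  have hdepXY : DependsOn (fun ω => X₀ ω * Y₀ ω) Fᶜ := fun ω ω' h => by
    show X₀ ω * Y₀ ω = X₀ ω' * Y₀ ω'
    rw [hdepX h, hdepY h]
  have hdep1 : DependsOn (fun _ : Config E => (1 : R)) Fᶜ := fun _ _ _ => rfl
  -- the masses on the four pieces, for the integrands 1, X, Y, XY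
  -- generic factorisation: a branch event `B₀ ∈ {C, Cᶜ}` times a reduced avoidance event
  have hfac : ∀ (B₀ : Set (Config E)) (hB₀ : DependsOn (· ∈ B₀) F) (X' : Finset V)
      (f : Config E → R) (hf : DependsOn f Fᶜ),
      massE p f (B₀ ∩ avoidEvent D₀ s X') = prob p B₀ * massE p f (avoidEvent D₀ s X') :=
    fun B₀ hB₀ X' f hf => massE_inter_of_dependsOn p F B₀ hB₀ f _ (hdep X' f hf)
  -- replacing the original markers by the reduced ones on each piece
  have hmX₁ : ∀ ω ∈ C ∩ R₁, X ω = X₀ ω := by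
    rintro ω ⟨hω, hω'⟩
    have hR : ω ∈ avoidEvent arcs s T := by
      rw [hRT]; exact Or.inl ⟨hω, hω'⟩
    exact marker_eq_of_outClosed arcs s w T a hω hR
  have hmY₁ : ∀ ω ∈ C ∩ R₁, Y ω = Y₀ ω := by
    rintro ω ⟨hω, hω'⟩
    have hR : ω ∈ avoidEvent arcs s T := by
      rw [hRT]; exact Or.inl ⟨hω, hω'⟩
    exact marker_eq_of_outClosed arcs s w T b hω hR
  have hmX₂ : ∀ ω ∈ Cᶜ ∩ R₂, X ω = X₀ ω := by
    rintro ω ⟨_, hω'⟩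
    have hR : ω ∈ avoidEvent arcs s Z := by rw [avoidEvent_arcsOff arcs hZZ s]; exact hω'
    exact marker_eq_of_avoid arcs s w T Z hZZ a hR
  have hmY₂ : ∀ ω ∈ Cᶜ ∩ R₂, Y ω = Y₀ ω := by
    rintro ω ⟨_, hω'⟩
    have hR : ω ∈ avoidEvent arcs s Z := by rw [avoidEvent_arcsOff arcs hZZ s]; exact hω'
    exact marker_eq_of_avoid arcs s w T Z hZZ b hR
  have hmX₃ : ∀ ω ∈ Cᶜ ∩ R₃, X ω = X₀ ω := by
    rintro ω ⟨_, hω'⟩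
    have hR : ω ∈ avoidEvent arcs s (insert u Z) := by
      rw [avoidEvent_arcsOff arcs hZ₃ s]; exact hω'
    exact marker_eq_of_avoid arcs s w T (insert u Z) hZ₃ a hR
  have hmY₃ : ∀ ω ∈ Cᶜ ∩ R₃, Y ω = Y₀ ω := by
    rintro ω ⟨_, hω'⟩
    have hR : ω ∈ avoidEvent arcs s (insert u Z) := by
      rw [avoidEvent_arcsOff arcs hZ₃ s]; exact hω'
    exact marker_eq_of_avoid arcs s w T (insert u Z) hZ₃ b hR
  -- the eight masses
  set c := prob p C with hc
  set c' := prob p Cᶜ with hc'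
  set P₁ := prob p R₁ with hP₁'
  set P₂ := prob p R₂ with hP₂'
  set P₃ := prob p R₃ with hP₃'
  set A₁ := massE p X₀ R₁ with hA₁
  set A₂ := massE p X₀ R₂ with hA₂
  set A₃ := massE p X₀ R₃ with hA₃
  set B₁ := massE p Y₀ R₁ with hB₁
  set B₂ := massE p Y₀ R₂ with hB₂
  set B₃ := massE p Y₀ R₃ with hB₃
  set C₁ := massE p (fun ω => X₀ ω * Y₀ ω) R₁ with hC₁
  set C₃ := massE p (fun ω => X₀ ω * Y₀ ω) R₃ with hC₃
  have eP : prob p (avoidEvent arcs s T) = c * P₁ + c' * P₂ := by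
    rw [hRT, prob_union_of_disjoint p hdisj₂, prob_eq_massE_one, prob_eq_massE_one,
      hfac C hCF T _ hdep1, hfac Cᶜ hCcF Z _ hdep1, ← prob_eq_massE_one, ← prob_eq_massE_one]
  have eA : massE p X (avoidEvent arcs s T) = c * A₁ + c' * A₂ := by
    rw [hRT, massE_union_of_disjoint p X hdisj₂, massE_congr p hmX₁, massE_congr p hmX₂,
      hfac C hCF T X₀ hdepX, hfac Cᶜ hCcF Z X₀ hdepX]
  have eB : massE p Y (avoidEvent arcs s T) = c * B₁ + c' * B₂ := by
    rw [hRT, massE_union_of_disjoint p Y hdisj₂, massE_congr p hmY₁, massE_congr p hmY₂,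
      hfac C hCF T Y₀ hdepY, hfac Cᶜ hCcF Z Y₀ hdepY]
  have ePG : prob p (gateEvent arcs s T u w) = c * P₁ + c' * P₃ := by
    rw [hG, prob_union_of_disjoint p hdisj₃, prob_eq_massE_one, prob_eq_massE_one,
      hfac C hCF T _ hdep1, hfac Cᶜ hCcF (insert u Z) _ hdep1, ← prob_eq_massE_one,
      ← prob_eq_massE_one]
  have eAG : massE p X (gateEvent arcs s T u w) = c * A₁ + c' * A₃ := by
    rw [hG, massE_union_of_disjoint p X hdisj₃, massE_congr p hmX₁, massE_congr p hmX₃,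
      hfac C hCF T X₀ hdepX, hfac Cᶜ hCcF (insert u Z) X₀ hdepX]
  have eBG : massE p Y (gateEvent arcs s T u w) = c * B₁ + c' * B₃ := by
    rw [hG, massE_union_of_disjoint p Y hdisj₃, massE_congr p hmY₁, massE_congr p hmY₃,
      hfac C hCF T Y₀ hdepY, hfac Cᶜ hCcF (insert u Z) Y₀ hdepY]
  have hmXY₁ : ∀ ω ∈ C ∩ R₁, X ω * Y ω = X₀ ω * Y₀ ω := fun ω hω => by
    rw [hmX₁ ω hω, hmY₁ ω hω]
  have hmXY₃ : ∀ ω ∈ Cᶜ ∩ R₃, X ω * Y ω = X₀ ω * Y₀ ω := fun ω hω => by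
    rw [hmX₃ ω hω, hmY₃ ω hω]
  have eCG : massE p (fun ω => X ω * Y ω) (gateEvent arcs s T u w) = c * C₁ + c' * C₃ := by
    rw [hG, massE_union_of_disjoint p _ hdisj₃, massE_congr p hmXY₁, massE_congr p hmXY₃,
      hfac C hCF T _ hdepXY, hfac Cᶜ hCcF (insert u Z) _ hdepXY]
  -- assemble
  unfold DARC phiC
  simp only []
  rw [eP, eA, eB, ePG, eAG, eBG, eCG]
  have hc0 : 0 ≤ c := prob_nonneg hp _
  have hc0' : 0 ≤ c' := prob_nonneg hp _
  have hcov₁' : A₁ * B₁ ≤ P₁ * C₁ := by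
    have := hcov₁
    simp only [covC] at this
    linarith
  have hcov₃' : A₃ * B₃ ≤ P₃ * C₃ := by
    have := hcov₃
    simp only [covC] at this
    linarith
  exact sink_alg hP₁ hP₂ hP₃ hc0 hc0' hcov₁' hcov₃' hA₁₂ hA₂₃ hB₁₂ hB₂₃

end Theorem

end Summit.Ventures.PercRepro2.Coin
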